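import Summits.ResolutionOfSingularities.ResolutionOfSingularities.Theorems.ValuativeLuAlphaPTorsorAdaptedDefs
import Summits.ResolutionOfSingularities.ResolutionOfSingularities.Theorems.ValuativeLuAlphaPTorsorTopCoarsening
import Summits.ResolutionOfSingularities.ResolutionOfSingularities.Theorems.ValuativeLuAlphaPTorsorTowerTools
import Summits.ResolutionOfSingularities.ResolutionOfSingularities.Theorems.ValuativeLuAlphaPTorsorResidueStep
import HarnessLib

/-!
# Flag-adapted charts are stable under adjoining inverses of units and under the residue step

Crux `Valuative.LuAlphaPTorsor` (stmt-ResolutionOfSingularities-0641), line `pfaff-line-log-final-forms`,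
lead seat c4 — F⁷ of the attack on the rank `≥ 2` Abhyankar core `stub_abhyankarHigherRankCore`:
the two parameter-preserving steps of the `α_p`-tower keep a FLAG-ADAPTED chart
(`FlagAdaptedChart`, `…AdaptedDefs`) flag-adapted, with the SAME parameters and levels:

* `ap_flag_adjoin_inv` — adjoining the inverse of an `O`-unit `w ∈ R`: every element of
  `R[w⁻¹]` is `r / w^N` (`exists_eq_div_pow_of_mem_adjoin_inv`, `…TowerTools`), and `r / w^N` is
  small at a level iff `r` is;
* `ap_flag_residueStep` — the residue step `R[t]`, `t^p = u ∈ R` a unit whose residue is not a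
  `p`-th power in the residue field of `Frac R`: every element of `R[t]` is `∑_{i<p} rᵢ tⁱ`
  (`residueStep_exists_sum_eq`), and if it is small for the COARSENING `W_ℓ` making the
  parameters of level `< ℓ` units (`topCoars_exists_W`, `…TopCoarsening`) then so is every `rᵢ`
  (`residueStep_valuation_coeff_lt_one` applied to `W_ℓ`: the residue of `u` is not a `p`-th
  power for `W_ℓ` either — an elementary value computation).

Anchor (closed form): `ap_flag_unit_W`. [folklore]
-/

set_option linter.dupNamespace false

open IsLocalRing

namespace Summit.ResolutionOfSingularities.ResolutionOfSingularities.Theorems.PfaffLine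

open Literature.AlgebraicGeometry.Resolution

/-- Anchor (closed form): an `O`-unit is a `W`-unit for every overring `W ⊇ O`. [folklore] -/
theorem ap_flag_unit_W : ∀ {K : Type} [Field K] (O W : ValuationSubring K), O ≤ W → ∀ z : K, O.valuation z = 1 → W.valuation z = 1 := by
  intro K _ O W hOW z hz
  have hz0 : z ≠ 0 := by rintro rfl; rw [map_zero] at hz; exact zero_ne_one hz
  have h1 : z ∈ W := hOW ((O.valuation_le_one_iff z).mp hz.le)
  have h2 : z⁻¹ ∈ W := hOW ((O.valuation_le_one_iff _).mp (by rw [map_inv₀, hz, inv_one]))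
  have hle := (W.valuation_le_one_iff z).mpr h1
  have hle' := (W.valuation_le_one_iff _).mpr h2
  rw [map_inv₀] at hle'
  exact le_antisymm hle ((inv_le_one₀ ((Valuation.pos_iff _).mpr hz0)).mp hle')

section Steps

variable {k K : Type} [Field k] [Field K] [Algebra k K]

/-- The level-`ℓ` coarsening of a flag-adapted chart and its basic properties: `O ≤ W_ℓ`,
`W_ℓ`-smallness is smallness against the monomials of level `< ℓ`, `W_ℓ`-small implies
`O`-small, and for `r ∈ R`: `W_ℓ`-small iff `r ∈ (x_{≥ ℓ})R`. [folklore] -/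
theorem ap_flag_level (O : ValuationSubring K) {n : ℕ} (R : Subalgebra k K)
    (hRO : R.toSubring ≤ O.toSubring) (x : Fin n → K) (hx : ∀ i, x i ∈ R) (lv : Fin n → ℕ)
    (hflag : FlagAdaptedChart O R hRO x hx lv) (ℓ : ℕ) :
    ∃ W : ValuationSubring K, O ≤ W ∧
      (∀ z : K, W.valuation z < 1 ↔
        ∀ m : Fin n → ℤ, (∀ j, ℓ ≤ lv j → m j = 0) → O.valuation z < ∏ j, O.valuation (x j) ^ (m j)) ∧
      (∀ z : K, W.valuation z < 1 → O.valuation z < 1) ∧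
      (∀ (r : R.toSubring), W.valuation (r : K) < 1 ↔
        r ∈ Ideal.span (Set.range fun i : {i : Fin n // ℓ ≤ lv i} => (⟨x i.1, hx i.1⟩ : R.toSubring))) := by
  obtain ⟨⟨-, hx0, -, -, -, hC3⟩, -⟩ := hflag
  obtain ⟨W, hW⟩ := topCoars_exists_W O x hx0 (fun j => ℓ ≤ lv j)
  have hsmall := fun z => topCoars_small_iff O x (fun j => ℓ ≤ lv j) W hx0 hW z
  have hOW : O ≤ W := fun z hz => (hW z).mpr ⟨0, fun _ _ => rfl, by simpa using (O.valuation_le_one_iff z).mpr hz⟩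
  have hWO : ∀ z : K, W.valuation z < 1 → O.valuation z < 1 := by
    intro z hz; have h := (hsmall z).mp hz 0 (fun _ _ => rfl); simpa using h
  refine ⟨W, hOW, hsmall, hWO, fun r => ?_⟩
  rw [hsmall, hC3 ℓ r]

/-- **Adjoining the inverse of a unit keeps a flag-adapted chart flag-adapted** (same parameters,
same levels). [folklore] -/
theorem ap_flag_adjoin_inv (O : ValuationSubring K) (hk : ∀ c : k, algebraMap k K c ∈ O) {n : ℕ}
    (R : Subalgebra k K) (hRO : R.toSubring ≤ O.toSubring) (x : Fin n → K) (hx : ∀ i, x i ∈ R)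
    (lv : Fin n → ℕ) (hflag : FlagAdaptedChart O R hRO x hx lv) (w : K) (hwR : w ∈ R)
    (hw : O.valuation w = 1) :
    ∃ (R' : Subalgebra k K) (hR'O : R'.toSubring ≤ O.toSubring) (hx' : ∀ i, x i ∈ R'),
      R' = Algebra.adjoin k (insert w⁻¹ (R : Set K)) ∧ R ≤ R' ∧ w⁻¹ ∈ R' ∧ R'.FG ∧
      ((R' : Set K) ⊆ Subfield.closure (R : Set K)) ∧ FlagAdaptedChart O R' hR'O x hx' lv := by
  classical
  obtain ⟨⟨hFG, hx0, hspan, hind, hAV, hC3⟩, hLA⟩ := id hflag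
  have hw0 : w ≠ 0 := by rintro rfl; rw [map_zero] at hw; exact zero_ne_one hw
  have hwiO : w⁻¹ ∈ O := (O.valuation_le_one_iff _).mp (by rw [map_inv₀, hw, inv_one])
  set R' : Subalgebra k K := Algebra.adjoin k (insert w⁻¹ (R : Set K)) with hR'
  have hRR' : R ≤ R' := fun z hz => Algebra.subset_adjoin (Set.mem_insert_of_mem _ hz)
  have hwi : w⁻¹ ∈ R' := Algebra.subset_adjoin (Set.mem_insert _ _)
  have hR'O : R'.toSubring ≤ O.toSubring := by
    intro z hz
    refine (Algebra.adjoin_le (S := { O.toSubring with algebraMap_mem' := fun c => hk c }) ?_) hz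
    rintro y (rfl | hy)
    · exact hwiO
    · exact hRO hy
  have hFG' : R'.FG := by
    obtain ⟨s, hs⟩ := hFG
    refine ⟨insert w⁻¹ s, ?_⟩
    rw [Finset.coe_insert, hR', ← hs, Algebra.adjoin_insert_adjoin]
  have hsub : (R' : Set K) ⊆ Subfield.closure (R : Set K) := by
    intro z hz
    refine (Algebra.adjoin_le (S := { (Subfield.closure (R : Set K)).toSubring with
      algebraMap_mem' := fun c => Subfield.subset_closure (R.algebraMap_mem c) }) ?_) hz
    rintro y (rfl | hy)
    · exact (Subfield.closure (R : Set K)).inv_mem (Subfield.subset_closure hwR)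
    · exact Subfield.subset_closure hy
  have hx' : ∀ i, x i ∈ R' := fun i => hRR' (hx i)
  -- elements of `R'` are `r / w^N`
  have hrep : ∀ z ∈ R', ∃ (r : K) (N : ℕ), r ∈ R ∧ z = r / w ^ N := fun z hz =>
    exists_eq_div_pow_of_mem_adjoin_inv R hwR hw0 (by rw [← hR']; exact hz)
  have hvdiv : ∀ (r : K) (N : ℕ), O.valuation (r / w ^ N) = O.valuation r := by
    intro r N; rw [map_div₀, map_pow, hw, one_pow, div_one]
  -- transporting ideal membership from `R` to `R'`
  have hpush : ∀ (q : Fin n → Prop) (r : K) (hr : r ∈ R) (N : ℕ) (hz : r / w ^ N ∈ R'),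
      (⟨r, hr⟩ : R.toSubring) ∈ Ideal.span (Set.range fun i : {i : Fin n // q i} => (⟨x i.1, hx i.1⟩ : R.toSubring)) →
      (⟨r / w ^ N, hz⟩ : R'.toSubring) ∈
        Ideal.span (Set.range fun i : {i : Fin n // q i} => (⟨x i.1, hx' i.1⟩ : R'.toSubring)) := by
    intro q r hr N hz hmem
    obtain ⟨c, hc⟩ := Ideal.mem_span_range_iff_exists_fun.mp hmem
    have hcK : (∑ i, (c i : K) * x i.1) = r := by
      have := congrArg (fun t : R.toSubring => (t : K)) hc
      simp only [AddSubmonoidClass.coe_finsetSum, Subring.coe_mul] at this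
      exact this
    have hwN : (w⁻¹) ^ N ∈ R' := pow_mem hwi N
    have : (⟨r / w ^ N, hz⟩ : R'.toSubring) =
        ∑ i, (⟨(c i : K) * (w⁻¹) ^ N, mul_mem (hRR' (c i).2) hwN⟩ : R'.toSubring) * ⟨x i.1, hx' i.1⟩ := by
      apply Subtype.ext
      push_cast
      rw [← hcK, div_eq_mul_inv, Finset.sum_mul, ← inv_pow]
      exact Finset.sum_congr rfl fun i _ => by ring
    rw [this]
    exact Submodule.sum_mem _ fun i _ => Ideal.mul_mem_left _ _ (Ideal.subset_span ⟨i, rfl⟩)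
  -- elements of `(x_q)R'` are combinations with small values
  have hsmall_of_mem : ∀ (q : Fin n → Prop) (g : (Fin n → ℤ) → Prop) (z : R'.toSubring),
      (∀ (i : Fin n), q i → ∀ m, g m → O.valuation (x i) < ∏ j, O.valuation (x j) ^ (m j)) →
      z ∈ Ideal.span (Set.range fun i : {i : Fin n // q i} => (⟨x i.1, hx' i.1⟩ : R'.toSubring)) →
      ∀ m, g m → O.valuation (z : K) < ∏ j, O.valuation (x j) ^ (m j) := by
    intro q g z hq hz m hm
    obtain ⟨c, hc⟩ := Ideal.mem_span_range_iff_exists_fun.mp hz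
    have hzK : (z : K) = ∑ i : {i : Fin n // q i}, (c i : K) * x i.1 := by
      have := congrArg (fun t : R'.toSubring => (t : K)) hc
      simp only [AddSubmonoidClass.coe_finsetSum, Subring.coe_mul] at this
      exact this.symm
    rw [hzK]
    have hpos : 0 < ∏ j, O.valuation (x j) ^ (m j) :=
      Finset.prod_pos fun j _ => zpow_pos ((Valuation.pos_iff _).mpr (hx0 j)) _
    refine Valuation.map_sum_lt _ (ne_of_gt hpos) fun i _ => ?_
    rw [map_mul]
    exact lt_of_le_of_lt (mul_le_of_le_one_left' ((O.valuation_le_one_iff _).mpr (hR'O (c i).2))) (hq i.1 i.2 m hm)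
  -- the `R`-side smallness of parameters (from (C3) for `R`, → direction)
  have hxsmall : ∀ (ℓ : ℕ) (i : Fin n), ℓ ≤ lv i → ∀ m : Fin n → ℤ, (∀ j, ℓ ≤ lv j → m j = 0) →
      O.valuation (x i) < ∏ j, O.valuation (x j) ^ (m j) := by
    intro ℓ i hi m hm
    have h := (hC3 ℓ ⟨x i, hx i⟩).mp (Ideal.subset_span ⟨⟨i, hi⟩, rfl⟩) m hm
    exact h
  refine ⟨R', hR'O, hx', rfl, hRR', hwi, hFG', hsub, ⟨⟨hFG', hx0, ?_, hind, hAV, ?_⟩, hLA⟩⟩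
  · -- span = centre for `R'`
    apply le_antisymm
    · rw [Ideal.span_le]
      rintro _ ⟨i, rfl⟩
      rw [SetLike.mem_coe, Ideal.mem_comap, ValuationSubring.valuation_lt_one_iff]
      have h := hxsmall 0 i (Nat.zero_le _) 0 (fun _ _ => rfl)
      simpa using h
    · intro z hz
      rw [Ideal.mem_comap, ValuationSubring.valuation_lt_one_iff] at hz
      change O.valuation (z : K) < 1 at hz
      obtain ⟨r, N, hr, hzr⟩ := hrep z z.2
      have hrv : O.valuation r < 1 := by rw [← hvdiv r N, ← hzr]; exact hz
      have hrmem : (⟨r, hr⟩ : R.toSubring) ∈ Ideal.comap (Subring.inclusion hRO) (maximalIdeal O) := by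
        rw [Ideal.mem_comap, ValuationSubring.valuation_lt_one_iff]; exact hrv
      rw [← hspan] at hrmem
      have hall : (⟨r, hr⟩ : R.toSubring) ∈ Ideal.span (Set.range fun i : {i : Fin n // True} => (⟨x i.1, hx i.1⟩ : R.toSubring)) := by
        refine Ideal.span_mono ?_ hrmem
        rintro _ ⟨i, rfl⟩; exact ⟨⟨i, trivial⟩, rfl⟩
      have hz' : r / w ^ N ∈ R' := by rw [← hzr]; exact z.2
      have h := hpush (fun _ => True) r hr N hz' hall
      have hzeq : z = ⟨r / w ^ N, hz'⟩ := Subtype.ext hzr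
      rw [hzeq]
      refine Ideal.span_mono ?_ h
      rintro _ ⟨i, rfl⟩; exact ⟨i.1, rfl⟩
  · -- (C3) for `R'`
    intro ℓ z
    constructor
    · intro hz
      exact hsmall_of_mem (fun i => ℓ ≤ lv i) (fun m => ∀ j, ℓ ≤ lv j → m j = 0) z
        (fun i hi m hm => hxsmall ℓ i hi m hm) hz
    · intro h
      obtain ⟨r, N, hr, hzr⟩ := hrep z z.2
      have hr' : ∀ m : Fin n → ℤ, (∀ j, ℓ ≤ lv j → m j = 0) → O.valuation r < ∏ j, O.valuation (x j) ^ (m j) := by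
        intro m hm; rw [← hvdiv r N, ← hzr]; exact h m hm
      have hrmem := (hC3 ℓ ⟨r, hr⟩).mpr hr'
      have hz' : r / w ^ N ∈ R' := by rw [← hzr]; exact z.2
      have hzeq : z = ⟨r / w ^ N, hz'⟩ := Subtype.ext hzr
      rw [hzeq]
      exact hpush (fun i => ℓ ≤ lv i) r hr N hz' hrmem

end Steps

end Summit.ResolutionOfSingularities.ResolutionOfSingularities.Theorems.PfaffLine
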